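import Literature.IUT.LogThetaLattice.GlobalPacketsLGPMonoidsOfGaussian
import Literature.IUT.HodgeArakelov.GoodPrimeKummerBridgeArch
import Mathlib.GroupTheory.GroupAction.ConjAct
import HarnessLib

/-!
# [IUTchIII] Proposition 3.4 (ii): the construct `LGPMonoidSignature.ofGaussian` INSTANTIATED at the genuine
# `p`-adic data — `M_v = 𝒪^▷_{K_v}`, `Ψ_{𝓕gau,v} = 𝒪^×_{K_v}·ξ_v^ℕ` with `ξ_{v,j} = ζ_{v,j}·q_v^{j²}`, Galois action trivial
# at the `G_v`-invariant level, log-link member = the inclusion `𝒪_{K_v} ⊆ K_v`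

S. Mochizuki, *Inter-universal Teichmüller theory III*, kurims manuscript (May 2020) `paper:url-4b091feeb646`, §3,
Proposition 3.4 (ii) pp. 102–103 and Fig. 3.1 p. 101 ("the splitting monoid at the label `j` is generated by
`q^{j²}`"); [IUTchII] Cor. 3.5 (ii)/(iii), 3.6 (iii) (`Ψ_{F_ξ}(†F_v) = (Ψ^×_{†C_v})_{⟨F_l^⋇⟩} · Im(ξ)^ℕ`), Rmk. 2.5.1 (i)
(`ξ_j ∈ μ_{2l}·q_v^{j²}`) [claim: Mochizuki2012, status: disputed] for every quoted phrase; abc-iut cell, layer L6, seat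
abc-iut-L6-t4 (typer of record of [IUTchIII] §3; gen 4). Sequel of `GlobalPacketsLGPMonoidsOfGaussian.lean` (p422157):
there `LGPMonoidSignature.ofValueProfile` is stated over an ABSTRACT †-side monoid `M_v` with a member
`ι_v : M_v →* K_v`; here every parameter except the theta-value data is the GENUINE one of the vertically coric
model (all Frobenius-like copies read in ONE `K_v`, [IUTchIII] Prop. 3.5 (i)):

* `M_v := 𝒪^▷_{K_v}` = the nonzero elements of norm `≤ 1` as a multiplicative monoid (abc-iut-L5-t2's
  `Literature.IUT.HodgeTheaters.unitDiscMonoid`, [IUTchI] Ex. 3.4 (i) "`𝒪^▷_{K_v}`"; its unit group IS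
  `𝒪^×_{K_v} = {‖u‖ = 1}` — abc-iut-L6-t5's `GoodPrimeKummer.isUnit_iff_norm_eq_one`, consumed BY NAME), so that
  abc-iut-L6-t2's `gaussianMonoid ξ = unitDiagonal ⊔ powers ξ` is LITERALLY `𝒪^×·ξ^ℕ` ([IUTchII] Cor. 3.6 (iii));
* `Γ_v := ConjAct (𝒪^▷_{K_v})^×` acting by conjugation — Mathlib's canonical action by monoid automorphisms, TRIVIAL
  because `𝒪^▷_{K_v}` is commutative: the model is "typed at the `G_v`-invariant level" (print p. 103 l. 6: at bad
  `v` only the Galois invariants are used), `padicModel_ΨGal_eq_Ψ`;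
* `ι_v := ` the inclusion `𝒪^▷_{K_v} ⊆ K_v` (the identity member of the log-link's full poly-isomorphism read in the
  one coric copy);
* `ξ_v := valueProfileOf q_v (j ↦ j²) ζ_v` with `0 < ‖q_v‖ ≤ 1` and `ζ_{v,j} ∈ (𝒪^▷_{K_v})^×` (the `2l`-th roots of
  unity of Rmk. 2.5.1 when `ζ^{2l} = 1`).
RESULTS: `LGPMonoidSignature.padicModel` (the signature over the real label-`j` packets `LGPPacket p K v j` and the
typed `𝓘^ℚ = lgpShellQ`); `mem_padicModel_Ψ_iff` — the label-`j` LGP-monoid is `ι(𝒪^×_{K_v}·(ζ_j q^{j²})^ℕ)` pushed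
into the packet by `toPacketAt_j` (the monoid of abc-iut-w5-d112's hand-built witness p419431, now an INSTANCE of
the construct); `padicModel_ΨGal_eq_Ψ`; `padicModel_ΨSplit_le` (splitting monoid ≤ abc-iut-L6-t2's
`splittingMonoidAt K_v 2l q_v j` pushed, the object of abc-iut-w4-d036's `prop35ii_c_shellPacketAt`).

HONEST SCOPE: GENUINE carriers/monoids/inclusion (no abstract parameter besides the theta-value data `q`, `ζ`);
the archimedean places and the `∞Ψ` root-extraction are as in p422157 (`inftyGaussianMonoid` over the abstract `rootPowers`); the Galois group is modelled by a trivially acting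
group (invariant level), not by `G_v` itself. No `Prop`-valued definition, no instance; nothing here asserts abc
proved or refuted or takes a side on [IUTchIII] Cor. 3.12; typed ≠ discharged; instantiated ≠ endorsed.
-/

noncomputable section

namespace Literature.IUT.LogThetaLattice

open Set Metric
open Literature.IUT.HodgeArakelov Literature.AnabelianGeometry.AbsoluteAnabelian

universe v' w

section PadicModel

variable (p : ℕ) [Fact p.Prime] {Vfib : Type v'} [Fintype Vfib]
variable (K : Vfib → Type w) [∀ v, NontriviallyNormedField (K v)] [∀ v, Algebra ℚ_[p] (K v)]
  [∀ v, IsBoundedSMul ℚ_[p] (K v)] [∀ v, IsUltrametricDist (K v)] [∀ v, CharZero (K v)]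
variable (Lg : ∀ v, PadicLogOnUnits (K v))

/-- `𝒪^▷_{K_v}` as a multiplicative monoid (abc-iut-L5-t2's `unitDiscMonoid`: nonzero elements of norm `≤ 1`) — the
genuine value of the †-side constant monoid carrier `M_v` of `LGPMonoidSignature.ofGaussian` ([IUTchII] Cor. 3.5 (i)
`Ψ_cns(M^Θ_*)_v ≅ 𝒪^▷_{F̄_v}`, read at the `G_v`-invariant level `K_v`). [cite: Mochizuki2012, Prop. 3.4 (ii) p.102]
[claim: Mochizuki2012, status: disputed] -/
abbrev intDisc (v : Vfib) : Type w := ↥(Literature.IUT.HodgeTheaters.unitDiscMonoid (K v))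

variable {lstar : ℕ} (isBad : Vfib → Prop) (twoL : ℕ)
variable (q : ∀ v, K v) (hq0 : ∀ v, q v ≠ 0) (hq : ∀ v, ‖q v‖ ≤ 1) (ζ : ∀ v, Fin lstar → (intDisc K v)ˣ)

/-- The `q`-parameter `q_v ∈ 𝒪^▷_{K_v}` ([IUTchI] Ex. 3.2 (iv); `q_v ≠ 0`, `‖q_v‖ ≤ 1`) as an element of the monoid
`M_v = 𝒪^▷_{K_v}`. [cite: Mochizuki2012, Prop. 3.4 (ii) p.102] [claim: Mochizuki2012, status: disputed] -/
def qDisc (v : Vfib) : intDisc K v := ⟨q v, hq0 v, hq v⟩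

/-- **[IUTchIII] Prop. 3.4 (ii) at the GENUINE `p`-adic data: `LGPMonoidSignature.padicModel`** — abc-iut-L6-t4's construct
`LGPMonoidSignature.ofValueProfile` (p422157) with `M_v := 𝒪_{K_v}`, `Γ_v := ConjAct (𝒪_{K_v})^×` (trivial action:
invariant level), `ι_v :=` the inclusion `𝒪_{K_v} ⊆ K_v`, value-profile `ξ_v = (ζ_{v,j} · q_v^{j²})_j` — carriers the real
label-`j` packets `LGPPacket p K v j`, `𝓘^ℚ = lgpShellQ` (typed). [cite: Mochizuki2012, Prop. 3.4 (ii) p.102]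
[claim: Mochizuki2012, status: disputed] -/
def LGPMonoidSignature.padicModel :
    LGPMonoidSignature lstar Vfib isBad (fun v j => LGPPacket p K v j) (fun v j => lgpShellQ p K Lg v j) :=
  LGPMonoidSignature.ofValueProfile p K Lg isBad (fun v => intDisc K v) (fun v => ConjAct (intDisc K v)ˣ)
    (fun v => (Literature.IUT.HodgeTheaters.unitDiscMonoid (K v)).subtype) twoL
    (fun v => valueProfileOf (qDisc K q hq0 hq v) (fun j => labelNat j ^ 2) (ζ v))

/-- At the invariant level the "Galois invariants" ARE the whole LGP-monoid: the conjugation action of `(𝒪_{K_v})^×` on the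
commutative monoid `𝒪^▷_{K_v}` is trivial (print p. 103 l. 6: at `v ∈ 𝕍^bad` only the Galois-invariant part is used).
[cite: Mochizuki2012, Prop. 3.4 (ii) p.103] [claim: Mochizuki2012, status: disputed] -/
theorem LGPMonoidSignature.padicModel_ΨGal_eq_Ψ (v : Vfib) (j : Fin lstar) :
    (LGPMonoidSignature.padicModel p K Lg isBad twoL q hq0 hq ζ).ΨGal v j =
      (LGPMonoidSignature.padicModel p K Lg isBad twoL q hq0 hq ζ).Ψ v j := by
  have hfix : galFixed (fun v => intDisc K v) (fun v => ConjAct (intDisc K v)ˣ) v =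
      (⊤ : Submonoid (Fin lstar → intDisc K v)) := by
    refine eq_top_iff.mpr fun x _ => ?_
    rw [galFixed, FixedPoints.mem_submonoid]
    intro g
    funext i
    rw [Pi.smul_apply, ConjAct.units_smul_def, mul_comm ((ConjAct.ofConjAct g : (intDisc K v)ˣ) : intDisc K v),
      Units.mul_inv_cancel_right]
  change lgpComponent p K (fun v => intDisc K v) _ v (_ ⊓ galFixed _ _ v) j = lgpComponent p K _ _ v _ j
  rw [hfix, inf_top_eq]

/-- **Fig. 3.1 / sub-DAG row r16 at the genuine data**: the label-`j` SPLITTING MONOID of the `p`-adic model lies in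
abc-iut-L6-t2's `splittingMonoidAt K_v 2l q_v j = μ_{2l} · q_v^{j²ℕ}` pushed into the packet by `toPacketAt_j` — the object
on which abc-iut-w4-d036 proved Prop. 3.5 (ii)(c) (`prop35ii_c_shellPacketAt`) — provided the `ζ_{v,j}` are `2l`-th roots
of unity ([IUTchII] Rmk. 2.5.1 (i)). [cite: Mochizuki2012, Prop. 3.4 (ii) p.102] [claim: Mochizuki2012, status: disputed] -/
theorem LGPMonoidSignature.padicModel_ΨSplit_le (hζ : ∀ v j, ζ v j ∈ rootsOfUnity twoL (intDisc K v))
    (v : Vfib) (h : isBad v) (j : Fin lstar) :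
    (LGPMonoidSignature.padicModel p K Lg isBad twoL q hq0 hq ζ).ΨSplit v h j ≤
      (splittingMonoidAt (K v) twoL (q v) (labelNat j)).map (toLGPPacket p K v j) :=
  LGPMonoidSignature.ofValueProfile_ΨSplit_le p K Lg isBad (fun v => intDisc K v)
    (fun v => ConjAct (intDisc K v)ˣ) (fun v => (Literature.IUT.HodgeTheaters.unitDiscMonoid (K v)).subtype) twoL
    (fun v => qDisc K q hq0 hq v) ζ hζ v h j

/-- **The label-`j` LGP-monoid of the `p`-adic model, explicitly**: `y ∈ Ψ_{𝓕LGP,v,j}` iff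
`y = toPacketAt_j (u · (ζ_{v,j} q_v^{j²})^n)` for a unit `u ∈ 𝒪^×_{K_v}` (`‖u‖ = 1`) and `n ∈ ℕ` — i.e. `Ψ_j = ι(𝒪^× · ξ_j^ℕ)`
pushed into `log(^{S^±_{j+1},j;‡}𝓕_v)` ([IUTchII] Cor. 3.6 (iii) `Ψ_{F_ξ} = Ψ^× · Im(ξ)^ℕ`; abc-iut-w5-d112's hand-built
witness p419431 has exactly this shape). [cite: Mochizuki2012, Prop. 3.4 (ii) p.102] [claim: Mochizuki2012, status: disputed] -/
theorem LGPMonoidSignature.mem_padicModel_Ψ_iff (v : Vfib) (j : Fin lstar) (y : LGPPacket p K v j) :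
    y ∈ (LGPMonoidSignature.padicModel p K Lg isBad twoL q hq0 hq ζ).Ψ v j ↔
      ∃ u : K v, ‖u‖ = 1 ∧ ∃ n : ℕ,
        y = toLGPPacket p K v j (u * (((ζ v j : intDisc K v) : K v) * q v ^ labelNat j ^ 2) ^ n) := by
  change y ∈ lgpComponent p K (fun v => intDisc K v) (fun v => (Literature.IUT.HodgeTheaters.unitDiscMonoid (K v)).subtype) v
    (gaussianMonoid (valueProfileOf (qDisc K q hq0 hq v) (fun j => labelNat j ^ 2) (ζ v))) j ↔ _
  rw [mem_lgpComponent_iff]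
  constructor
  · rintro ⟨x, hx, rfl⟩
    obtain ⟨w, n, rfl⟩ := (mem_gaussianMonoid_iff _ x).mp hx
    refine ⟨((w : intDisc K v) : K v), GoodPrimeKummer.norm_eq_one_of_isUnit w.isUnit, n, ?_⟩
    simp [lgpPush, qDisc, valueProfileOf_apply]
  · rintro ⟨u, hu, n, rfl⟩
    have hu0 : u ≠ 0 := fun h => by simp [h] at hu
    obtain ⟨w, hw⟩ := GoodPrimeKummer.isUnit_of_norm_eq_one
      (z := (⟨u, hu0, hu.le⟩ : Literature.IUT.HodgeTheaters.unitDiscMonoid (K v))) hu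
    refine ⟨(fun _ => (w : intDisc K v)) * valueProfileOf (qDisc K q hq0 hq v) (fun j => labelNat j ^ 2) (ζ v) ^ n,
      (mem_gaussianMonoid_iff _ _).mpr ⟨w, n, rfl⟩, ?_⟩
    simp [lgpPush, qDisc, valueProfileOf_apply, hw]

end PadicModel

end Literature.IUT.LogThetaLattice

end
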